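import Summits.QuantumFields.BalabanUV.T4Continuum.Support.SliceFlatGradient

/-!
# G-an2-4 ∕ (CONV-C), INTERFACE REQUEST (B5-1115-TABLE), item (E3), step 1: [B5] (1.110) THIRD ENTRY «G∇*» AT `U = 1` IN
# KERNEL FORM ON THE NE3 CARRIER — cube sums of the COLUMN-differenced flat propagator `Σ_{q ∈ Δ_j(y₁)} |G_j(p, q+e_ν) − G_j(p,q)|`,
# exponentially localised, uniform in the spacing (the transposed resolvent identity)

G-an2-4 formalisation swarm `b2b-balaban-gan24-formalise-*`, leaf prover 04 (gen 46), crux team (2) under the coordinator ruling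
«YM REDIRECT» (e34b3e0c); toward the road-P2 crux prover's **INTERFACE REQUEST G-an2-4: (B5-1115-TABLE)** item **(E3)**
`B5Prop12Entries110.Entry110GDiv` («|(G∇_ν^*J)(x)| ≤ C·e^{−δ|y−y′|}|J|»).  The kernel of `G∇_ν^*` is the COLUMN difference of
the kernel of `G`: `(G∇_ν^*)(x,x′) = n·(G(x, x′+e_ν) − G(x,x′))`, so the third entry asks for cube sums IN THE COLUMN VARIABLE of
the column-differenced kernel — NOT the NE3 lineage's row statement `SliceFlatGradient.cubeSum_rowDiff_gFlat_le` (row-differenced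
kernel, cube sums in the column variable) nor its «column form» `cubeSum_gFlat_colDiff_le` (the same numbers, summed over the ROW
variable).  THIS FILE proves the missing statement on the NE3 carrier `(ℤ/N·L^k)^{d+1} × Fin (d+1)` with NE3's own three weighted
inputs, by TRANSPOSING the resolvent identity of `SliceFlatGradientPrep`:
 * §1 SYMMETRY: the unit vector-Laplacian stencil `stencilE` is symmetric (`stencilE_transpose`), hence so are `kFlat j` (positive
   definite) and the comparison form `Wfl j = stencilE + n⁻²·1 − kFlat j` (`Wfl_transpose`);
 * §2 THE COLUMN-DIFFERENCED RESOLVENT IDENTITY: `Aᵀ·colDiff ν = (rowDiff ν A)ᵀ` for every `A`, and from `gFlat = F + F·W·gFlat`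
   (`gFlat_eq_free_add`), `gFlatᵀ = gFlat`, `Wᵀ = W`:  **`gFlat·colDiff ν = (rowDiff ν F)ᵀ + gFlat·W·(rowDiff ν F)ᵀ`** — the column
   differences land on the FREE operator both times;
 * §3 REFLECTION: the weighted rows of `(rowDiff ν F)ᵀ` equal the weighted rows of `rowDiff ν F` (the free operator is a convolution
   kernel `freeKer(p₁ − q₁)`; reflect the column site through the row site: `z ↦ (2p₁ − z₁, z₂)`), so NE3's free gradient input
   `weightedRow_rowDiff_freeOp` bounds them: `≤ C_F·L^j`;
 * §4 END **`cubeSum_gFlat_mul_colDiff_le`**: `∃ B₂ δ > 0` (functions of `d`; the SAME constants as NE3's row statement) with, for all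
   `k N L`, `j ≤ k`, `ν`, `p`, `y₁`: `Σ_{q : cubeI j q = y₁} |(gFlat j·colDiff ν)(p,q)| ≤ B₂·L^j·e^{−δ·nbd_j(cubeI j p, y₁)}` — weighted
   rows are submultiplicative (`weightedRow_mul_le`: `C_F L^j·(1 + C_W L^{−2j}·C_G L^{2j})`) and WEIGHTED ⇒ CUBE-LOCALISED
   (`cubeSum_le_of_weightedRow`).
Step 2 (file `GAN24/Entry110GDivCubic`): transport to pv15's carrier `Tor (fine n M) × Fin (d+1)` and the (1.110) sup entry on cubic tori.

HONEST SCOPE.  `U = 1`, `a = 1`; the NE3 carrier has ONE period for all directions (CUBIC tori); constants NE3's; nothing printed is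
asserted — [B5] `Balaban1984PropagatorsI` p. 35 (1.110) is a TEXT LOCATION; the analysis (heat-kernel free gradient, resolvent identity,
(3.49) entry bound) is t4-ne3-p1's (gens 13–15), used BY NAME; this file adds one transpose and one reflection.  No `def`, no
`def … : Prop`, no `sorry`.  NOT (CONV-C), NEVER «G-an2-4 closed», NOT NE2 ∕ NE3, NOT D1, NOT BetaPertH, NOT continuum, NOT Clay; not in
print — our bookkeeping.  ABSOLUTE RULE of the cell kept.  HONEST DEPENDENCY: continuum YM on T⁴ ⇐ BetaPertH ∧ nine spine estimates
(0/9 proved); BetaPertH ⇐ (D1) ∧ (D4) ∧ CAP+tail; G-an2-4 gates asym, D1 and NE2/3/4.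
-/

noncomputable section

open Real Finset Matrix

namespace Summit.QuantumFields.BalabanUV.Beta.GAN24.Entry110GDivFlat

open Literature.MathematicalPhysics.QuantumFieldTheory.Balaban1983to89
open Literature.MathematicalPhysics.QuantumFieldTheory.Balaban1983to89.TreeLengthTorus (TPt)
open Literature.MathematicalPhysics.QuantumFieldTheory.Balaban1983to89.B12Decay510Torus (pl1_sub_comm)
open Literature.MathematicalPhysics.QuantumFieldTheory.Balaban1983to89.T4SliceOperatorData (countConst countConst_pos)
open Summit.QuantumFields.BalabanUV.T4Continuum
open SliceTorusBlocks SliceTorusTower SliceCovariantModel SliceCovariantTower SliceFlatPropagator SliceFlatOperators SliceFlatStencil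
open SliceFlatGaugeDecay SliceFlatFreeResolvent SliceFlatGradientPrep SliceFlatGradient

variable (d k N L : ℕ)

/-! ## §1 Symmetry of the stencil, of `kFlat` and of the comparison form -/

/-- Kronecker deltas with equivalent conditions agree. [folklore] -/
private theorem kd_congr {p q p' q' : TPt (d + 1) (N * L ^ k) × Fin (d + 1)} (h : p = q ↔ p' = q') :
    kd d k N L p q = kd d k N L p' q' := by
  unfold kd
  by_cases hpq : p = q
  · rw [if_pos hpq, if_pos (h.mp hpq)]
  · rw [if_neg hpq, if_neg fun h' => hpq (h.mpr h')]

/-- **The unit vector-Laplacian stencil is symmetric**: `stencilEᵀ = stencilE` (the forward and backward neighbour deltas swap).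
[folklore] -/
theorem stencilE_transpose : (stencilE d k N L).transpose = stencilE d k N L := by
  ext p q
  rw [Matrix.transpose_apply]
  unfold stencilE
  refine Finset.sum_congr rfl fun ν _ => ?_
  have h0 : kd d k N L q p = kd d k N L p q := kd_congr d k N L eq_comm
  have h1 : kd d k N L (q.1 + Pi.single ν 1, q.2) p = kd d k N L (p.1 - Pi.single ν 1, p.2) q := by
    refine kd_congr d k N L ⟨fun h => ?_, fun h => ?_⟩
    · obtain ⟨ha, hb⟩ := Prod.ext_iff.mp h
      simp only at ha hb
      exact Prod.ext (by simp only; rw [← ha, add_sub_cancel_right]) (by simp only; exact hb.symm)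
    · obtain ⟨ha, hb⟩ := Prod.ext_iff.mp h
      simp only at ha hb
      exact Prod.ext (by simp only; rw [← ha, sub_add_cancel]) (by simp only; exact hb.symm)
  have h2 : kd d k N L (q.1 - Pi.single ν 1, q.2) p = kd d k N L (p.1 + Pi.single ν 1, p.2) q := by
    refine kd_congr d k N L ⟨fun h => ?_, fun h => ?_⟩
    · obtain ⟨ha, hb⟩ := Prod.ext_iff.mp h
      simp only at ha hb
      exact Prod.ext (by simp only; rw [← ha, sub_add_cancel]) (by simp only; exact hb.symm)
    · obtain ⟨ha, hb⟩ := Prod.ext_iff.mp h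
      simp only at ha hb
      exact Prod.ext (by simp only; rw [← ha, add_sub_cancel_right]) (by simp only; exact hb.symm)
  rw [h0, h1, h2]
  ring

variable [NeZero N] [NeZero L]

/-- `kFlat j` is symmetric (real positive definite, hence Hermitian). [folklore] -/
theorem kFlat_transpose (j : ℕ) : (kFlat d k N L j).transpose = kFlat d k N L j := by
  have h := (kFlat_posDef d k N L j).isHermitian
  rwa [Matrix.IsHermitian, Matrix.conjTranspose_eq_transpose_of_trivial] at h

/-- **The comparison form is symmetric**: `(Wfl j)ᵀ = Wfl j` (`Wfl j = stencilE + n⁻²·1 − kFlat j`). [folklore] -/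
theorem Wfl_transpose (j : ℕ) : (Wfl d k N L j).transpose = Wfl d k N L j := by
  rw [Wfl_eq, Matrix.transpose_sub, Matrix.transpose_add, Matrix.transpose_smul, Matrix.transpose_one, stencilE_transpose,
    kFlat_transpose]

/-! ## §2 The column-differenced resolvent identity -/

/-- `Aᵀ·colDiff ν = (rowDiff ν A)ᵀ`: column differences of the transpose are transposed row differences. [folklore] -/
theorem transpose_mul_colDiff (ν : Fin (d + 1))
    (A : Matrix (TPt (d + 1) (N * L ^ k) × Fin (d + 1)) (TPt (d + 1) (N * L ^ k) × Fin (d + 1)) ℝ) :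
    A.transpose * colDiff d k N L ν = (rowDiff d k N L ν A).transpose := by
  ext p q
  rw [mul_colDiff_apply]
  simp only [Matrix.transpose_apply, rowDiff]

/-- The transposed resolvent identity: `gFlat j = Fᵀ + gFlat j·W·Fᵀ` (`F = freeOp j`, `W = Wfl j`; `gFlat`, `W` symmetric). [folklore] -/
theorem gFlat_eq_freeT_add (j : ℕ) :
    gFlat d k N L j = (freeOp d k N L j).transpose
      + gFlat d k N L j * Wfl d k N L j * (freeOp d k N L j).transpose := by
  have h := congrArg Matrix.transpose (gFlat_eq_free_add d k N L j)
  rw [gFlat_transpose, Matrix.transpose_add, Matrix.transpose_mul, Matrix.transpose_mul, gFlat_transpose, Wfl_transpose,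
    ← Matrix.mul_assoc] at h
  exact h

/-- **THE COLUMN-DIFFERENCED RESOLVENT IDENTITY**: `gFlat j·colDiff ν = (rowDiff ν F)ᵀ + gFlat j·W·(rowDiff ν F)ᵀ` — the column
differences of the full flat propagator are carried by the ROW differences of the FREE operator. [folklore] -/
theorem gFlat_mul_colDiff_eq (j : ℕ) (ν : Fin (d + 1)) :
    gFlat d k N L j * colDiff d k N L ν
      = (rowDiff d k N L ν (freeOp d k N L j)).transpose
        + gFlat d k N L j * Wfl d k N L j * (rowDiff d k N L ν (freeOp d k N L j)).transpose := by
  conv_lhs => rw [gFlat_eq_freeT_add d k N L j]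
  rw [Matrix.add_mul, transpose_mul_colDiff, Matrix.mul_assoc (gFlat d k N L j * Wfl d k N L j), transpose_mul_colDiff]

/-! ## §3 Weighted rows of the transposed free gradient, by reflection -/

/-- **Weighted rows of `(rowDiff ν F)ᵀ` = weighted rows of `rowDiff ν F`** (`F = freeOp j` is the convolution kernel
`[p₂ = q₂]·freeKer(p₁ − q₁)`; reflect the column site through the row site, `z ↦ (2x₁ − z₁, z₂)`; the weight `e^{δρ(x,z)/n}` is
reflection invariant), hence NE3's free gradient input (F) bounds them: `≤ C_F·L^j·e^{δ(d+1)}·2^{d+1}·countConst(freeα − δ, d+1)`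
for `j ≤ k`, `0 ≤ δ < freeα d`. [folklore] -/
theorem weightedRow_transpose_rowDiff_freeOp {j : ℕ} (hj : j ≤ k) (ν : Fin (d + 1)) {δ : ℝ} (hδ : 0 ≤ δ) (hδ₀ : δ < freeα d)
    (x : TPt (d + 1) (N * L ^ k) × Fin (d + 1)) :
    ∑ z, |(rowDiff d k N L ν (freeOp d k N L j)).transpose x z| * wE d k N L j δ x z
      ≤ freeC d * (L : ℝ) ^ j * Real.exp (δ * (d + 1)) * ((2 : ℝ) ^ (d + 1) * countConst (freeα d - δ) (d + 1)) := by
  -- the reflection of the site through `x₁`, an involution of the carrier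
  let R : TPt (d + 1) (N * L ^ k) × Fin (d + 1) ≃ TPt (d + 1) (N * L ^ k) × Fin (d + 1) :=
    { toFun := fun z => (x.1 + x.1 - z.1, z.2)
      invFun := fun z => (x.1 + x.1 - z.1, z.2)
      left_inv := fun z => by simp only [sub_sub_cancel]
      right_inv := fun z => by simp only [sub_sub_cancel] }
  have hsum : ∑ z, |(rowDiff d k N L ν (freeOp d k N L j)).transpose x z| * wE d k N L j δ x z
      = ∑ z, |rowDiff d k N L ν (freeOp d k N L j) x z| * wE d k N L j δ x z := by
    refine Fintype.sum_equiv R _ _ fun z => ?_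
    have hR : R z = (x.1 + x.1 - z.1, z.2) := rfl
    have h1 : (rowDiff d k N L ν (freeOp d k N L j)).transpose x z = rowDiff d k N L ν (freeOp d k N L j) x (R z) := by
      rw [hR, Matrix.transpose_apply]
      simp only [rowDiff, freeOp]
      have e1 : z.1 + Pi.single ν 1 - x.1 = x.1 + Pi.single ν 1 - (x.1 + x.1 - z.1) := by abel
      have e2 : z.1 - x.1 = x.1 - (x.1 + x.1 - z.1) := by abel
      rw [e1, e2]
      by_cases hc : z.2 = x.2
      · rw [if_pos hc, if_pos hc, if_pos hc.symm, if_pos hc.symm]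
      · rw [if_neg hc, if_neg hc, if_neg (Ne.symm hc), if_neg (Ne.symm hc)]
    have h2 : wE d k N L j δ x z = wE d k N L j δ x (R z) := by
      rw [hR]
      simp only [wE, rhoI, rho]
      have e3 : x.1 - (x.1 + x.1 - z.1) = z.1 - x.1 := by abel
      rw [e3, pl1_sub_comm]
    rw [h1, h2]
  rw [hsum]
  exact weightedRow_rowDiff_freeOp d k N L hj ν hδ hδ₀ x

/-! ## §4 END: cube sums of the column-differenced flat propagator in the column variable -/

/-- **[B5] (1.110) THIRD ENTRY `G∇*` AT `U = 1` IN KERNEL FORM ON THE NE3 CARRIER**: there are `B₂, δ > 0` (functions of `d`) such that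
for all `k N L`, every level `j ≤ k`, every direction `ν`, every row `p` and every level-`j` block `y₁`,
`Σ_{q : cubeI j q = y₁} |(gFlat j·colDiff ν)(p,q)| = Σ_{q ∈ Δ_j(y₁)} |gFlat j (p, q+e_ν) − gFlat j (p,q)| ≤ B₂·L^j·e^{−δ·nbd_j(cubeI j p, y₁)}`
— by the column-differenced resolvent identity (§2), the reflection (§3), NE3's three weighted inputs (G) `weightedRow_gFlat`,
(F) `weightedRow_rowDiff_freeOp`, (W) `weightedRow_Wfl` with the (3.49) entry bound `flatNg_le_349`, submultiplicativity
`weightedRow_mul_le`, and WEIGHTED ⇒ CUBE-LOCALISED `cubeSum_le_of_weightedRow`; the constants are literally those of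
`cubeSum_rowDiff_gFlat_le`.  (Location of the printed text: [B5] `Balaban1984PropagatorsI` p. 35, (1.110), third entry; the typed
inequality is not a quotation.) [folklore] -/
theorem cubeSum_gFlat_mul_colDiff_le :
    ∃ B₂ δ : ℝ, 0 < B₂ ∧ 0 < δ ∧ ∀ (k N L : ℕ) [NeZero N] [NeZero L] (j : ℕ), j ≤ k →
      ∀ (ν : Fin (d + 1)) (p : TPt (d + 1) (N * L ^ k) × Fin (d + 1)) (y₁ : TPt (d + 1) (levM k N L j)),
        ∑ q ∈ Finset.univ.filter (fun q => cubeI (d + 1) k N L (Fin (d + 1)) j q = y₁),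
            |(gFlat d k N L j * colDiff d k N L ν) p q|
          ≤ B₂ * (L : ℝ) ^ j * Real.exp (-(δ * nbd (d + 1) k N L j (cubeI (d + 1) k N L (Fin (d + 1)) j p) y₁)) := by
  obtain ⟨δ₁, C₁, hδ₁, hC₁, h349⟩ := flatNg_le_349 d
  obtain ⟨hα0, -⟩ := freeα_pos_le d
  have hf0 := flatδ₀_pos d
  set δ : ℝ := min (min (flatδ₀ d) (freeα d)) (δ₁ / 2) / 2 with hδdef
  have hmin : 0 < min (min (flatδ₀ d) (freeα d)) (δ₁ / 2) := lt_min (lt_min hf0 hα0) (by linarith)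
  have hδ : 0 < δ := by rw [hδdef]; linarith
  have hδf : δ < flatδ₀ d := by
    have : min (min (flatδ₀ d) (freeα d)) (δ₁ / 2) ≤ flatδ₀ d := (min_le_left _ _).trans (min_le_left _ _)
    rw [hδdef]; linarith
  have hδa : δ < freeα d := by
    have : min (min (flatδ₀ d) (freeα d)) (δ₁ / 2) ≤ freeα d := (min_le_left _ _).trans (min_le_right _ _)
    rw [hδdef]; linarith
  have hδ1 : δ < δ₁ / 2 := by
    have : min (min (flatδ₀ d) (freeα d)) (δ₁ / 2) ≤ δ₁ / 2 := min_le_right _ _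
    rw [hδdef]; linarith
  set KK : ℝ := Real.exp (δ * (d + 1)) * (2 : ℝ) ^ (d + 1) with hKK
  set CG : ℝ := flatB₀ d * KK * countConst (flatδ₀ d - δ) (d + 1) with hCG
  set CF : ℝ := freeC d * KK * countConst (freeα d - δ) (d + 1) with hCF
  set CW : ℝ := 1 + ((d : ℝ) + 1) * KK * countConst 1 (d + 1) + ((d : ℝ) + 1) * C₁ * KK * countConst (δ₁ / 2 - δ) (d + 1)
    with hCW
  have hKK0 : 0 < KK := by rw [hKK]; positivity
  have hcG := countConst_pos (sub_pos.2 hδf) (d + 1)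
  have hcF := countConst_pos (sub_pos.2 hδa) (d + 1)
  have hc1 := countConst_pos one_pos (d + 1)
  have hcW := countConst_pos (sub_pos.2 hδ1) (d + 1)
  have hCG0 : 0 ≤ CG := by rw [hCG]; exact mul_nonneg (mul_nonneg (flatB₀_nonneg d) hKK0.le) hcG.le
  have hCF0 : 0 < CF := by rw [hCF]; unfold freeC; positivity
  have hCW0 : 0 ≤ CW := by rw [hCW]; positivity
  refine ⟨CF * (1 + CW * CG) * Real.exp (δ * (d + 1)), δ, by positivity, hδ, fun k N L _ _ j hj ν p y₁ => ?_⟩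
  have hL : (0 : ℝ) < (L : ℝ) := by exact_mod_cast Nat.pos_of_ne_zero (NeZero.ne L)
  have hLj : (0 : ℝ) < (L : ℝ) ^ j := pow_pos hL j
  obtain ⟨hEpos, hEtri, -⟩ := wE_facts d k N L j hδ.le
  have hG : ∀ x, ∑ z, |gFlat d k N L j x z| * wE d k N L j δ x z ≤ CG * ((L : ℝ) ^ j) ^ 2 := fun x =>
    (weightedRow_gFlat d k N L hj hδ.le hδf x).trans (le_of_eq (by rw [hCG, hKK]; ring))
  have hFT : ∀ x, ∑ z, |(rowDiff d k N L ν (freeOp d k N L j)).transpose x z| * wE d k N L j δ x z ≤ CF * (L : ℝ) ^ j :=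
    fun x => (weightedRow_transpose_rowDiff_freeOp d k N L hj ν hδ.le hδa x).trans (le_of_eq (by rw [hCF, hKK]; ring))
  have hW : ∀ x, ∑ z, |Wfl d k N L j x z| * wE d k N L j δ x z ≤ CW * (((L : ℝ) ^ j) ^ 2)⁻¹ := fun x =>
    (weightedRow_Wfl d k N L hj hδ.le hδ1 hC₁.le (h349 k N L j hj) x).trans (le_of_eq (by rw [hCW, hKK]; ring))
  have hGW : ∀ x, ∑ z, |(gFlat d k N L j * Wfl d k N L j) x z| * wE d k N L j δ x z
      ≤ (CG * ((L : ℝ) ^ j) ^ 2) * (CW * (((L : ℝ) ^ j) ^ 2)⁻¹) :=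
    weightedRow_mul_le _ _ _ (by positivity) (fun x z => (hEpos x z).le) hEtri hG hW
  have hGWF : ∀ x, ∑ z, |(gFlat d k N L j * Wfl d k N L j * (rowDiff d k N L ν (freeOp d k N L j)).transpose) x z|
        * wE d k N L j δ x z
      ≤ ((CG * ((L : ℝ) ^ j) ^ 2) * (CW * (((L : ℝ) ^ j) ^ 2)⁻¹)) * (CF * (L : ℝ) ^ j) :=
    weightedRow_mul_le _ _ _ (by positivity) (fun x z => (hEpos x z).le) hEtri hGW hFT
  have hrow : ∑ z, |(gFlat d k N L j * colDiff d k N L ν) p z| * wE d k N L j δ p z ≤ CF * (1 + CW * CG) * (L : ℝ) ^ j := by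
    rw [gFlat_mul_colDiff_eq]
    calc ∑ z, |((rowDiff d k N L ν (freeOp d k N L j)).transpose
            + gFlat d k N L j * Wfl d k N L j * (rowDiff d k N L ν (freeOp d k N L j)).transpose) p z| * wE d k N L j δ p z
        ≤ ∑ z, (|(rowDiff d k N L ν (freeOp d k N L j)).transpose p z| * wE d k N L j δ p z
            + |(gFlat d k N L j * Wfl d k N L j * (rowDiff d k N L ν (freeOp d k N L j)).transpose) p z|
              * wE d k N L j δ p z) := by
          refine Finset.sum_le_sum fun z _ => ?_
          rw [Matrix.add_apply, ← add_mul]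
          exact mul_le_mul_of_nonneg_right (abs_add_le _ _) (hEpos p z).le
      _ ≤ CF * (L : ℝ) ^ j + ((CG * ((L : ℝ) ^ j) ^ 2) * (CW * (((L : ℝ) ^ j) ^ 2)⁻¹)) * (CF * (L : ℝ) ^ j) := by
          rw [Finset.sum_add_distrib]; exact add_le_add (hFT p) (hGWF p)
      _ = CF * (1 + CW * CG) * (L : ℝ) ^ j := by field_simp
  have h := cubeSum_le_of_weightedRow d k N L j (gFlat d k N L j * colDiff d k N L ν) hδ.le p hrow y₁
  calc _ ≤ _ := h
    _ = _ := by ring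

end Summit.QuantumFields.BalabanUV.Beta.GAN24.Entry110GDivFlat

end
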